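import Mathlib.Analysis.SpecialFunctions.Pow.Deriv
import Mathlib.Analysis.SpecialFunctions.Sqrt
import Literature.Analysis.FluidPDE.TwoPointComparison
import HarnessLib

/-!
# Drift–diffusion with a Type-I drift: the similarity barrier and THEOREM U from a one-dimensional profile

Topic `Literature/Analysis/FluidPDE` (family `ns`).  The LINEAR passive-scalar model `(SL)`
`∂ₜθ + b·∇θ = Δθ` behind the registered stub `stub_scalarLiouville` of crux `PoloidalLiouville`
(stmt-NavierStokesRegularity-1222, wall W1), for drifts of TYPE-I SIZE `√(−t)‖b(t,x)‖ ≤ C` — no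
divergence condition, any finite dimension.  The file's one one-dimensional input is a
PROFILE `k` with `4k″ + (2C − ρ/2)k′ + λk ≤ 0`, `k′ ≥ 0`, `k(0) > 0` (explicit hypotheses; the deterministic
shadow of Lemma 2.3 of `pub/ns-exp-scalarLiouville/MAP.md` rev 2, whose sharp choice is the principal
Dirichlet eigenfunction of the killed Ornstein–Uhlenbeck operator `𝒜_C`), and
`TypeIDrift.typeIDrift_twoPoint_oscillation_of_barrier` proves THEOREM U from it: for a bounded `C²`
solution on `(t₀,0) × E`, `t₀ < t₁ ≤ t < 0`, `‖x − y‖ ≤ 2ρ̄√(−t)`: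
`|θ(t,x) − θ(t,y)| ≤ 2·M·A·(t/t₁)^λ` — by `TwoPoint.twoPoint_comparison` with the similarity barrier
`φ(s,r) = (2M/k(0))·(s/t₁)^λ·k(r/√(−s))`, for which
`φ_s − 4φ_rr − 2(C/√−s)φ_r = −((2M/k(0))(s/t₁)^λ/(−s))·(4k″ + (2C − ρ/2)k′ + λk) ≥ 0`.
The input is DISCHARGED (explicit non-sharp profile) in `DriftDiffusionTypeIDriftOscillation`.
WHAT THIS IS NOT: a statement about the LINEAR model `(SL)` `∂ₜθ + b·∇θ = Δθ` only; nothing here proves or refutes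
`stub_scalarLiouville`, `PoloidalLiouville` (stmt-NavierStokesRegularity-1222) or Navier–Stokes regularity.
References: experiment cell `pub/ns-exp-scalarLiouville/MAP.md` rev 2 (sha16 12bf014d3d6c2eb8) §2;
G. Koch, N. Nadirashvili, G. Seregin, V. Šverák, Acta Math. 203 (2009) Thm 5.2 (the axisymmetric
no-swirl Liouville theorem this models; COR U2 of the MAP) [KochNadirashviliSereginSverak2009];
G. Seregin, L. Silvestre, V. Šverák, A. Zlatoš, J. Differential Equations 252 (2012) (Liouville theorems /
counterexamples for critical drifts) [SereginSilvestreSverakZlatos2012].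
-/

noncomputable section

open Set Function Filter Metric Topology InnerProductSpace
open scoped RealInnerProductSpace Laplacian Topology

namespace Literature.Analysis.FluidPDE

namespace TypeIDrift

open TwoPoint

/-! ### §4 The similarity barrier and THEOREM U from a one-dimensional profile -/

section Barrier

variable {E : Type*} [NormedAddCommGroup E] [InnerProductSpace ℝ E] [FiniteDimensional ℝ E]

/-- `d/ds √(−s) ⁻¹ = 1/(2(−s)√(−s))` for `s < 0`. [folklore] -/
private theorem hasDerivAt_inv_sqrt_neg {s : ℝ} (hs : s < 0) :
    HasDerivAt (fun σ : ℝ => (Real.sqrt (-σ))⁻¹) (1 / (2 * (-s) * Real.sqrt (-s))) s := by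
  have hs' : 0 < -s := by linarith
  have hu : 0 < Real.sqrt (-s) := Real.sqrt_pos.2 hs'
  have h1 : HasDerivAt (fun σ : ℝ => -σ) (-1) s := (hasDerivAt_id' s).neg
  have h2 : HasDerivAt (fun σ : ℝ => Real.sqrt (-σ)) (-1 / (2 * Real.sqrt (-s))) s := h1.sqrt hs'.ne'
  have h3 : HasDerivAt (fun σ : ℝ => (Real.sqrt (-σ))⁻¹)
      (-(-1 / (2 * Real.sqrt (-s))) / Real.sqrt (-s) ^ 2) s := h2.inv hu.ne'
  refine h3.congr_deriv ?_
  rw [Real.sq_sqrt hs'.le]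
  field_simp

/-- **THEOREM U from a profile** (two-point oscillation decay for Type-I drifts, GIVEN a one-dimensional
PROFILE `k`: twice differentiable with `k′ = k'`, `k″ = k''`, `k(0) > 0`, `k ≥ k(0)` on `[0,∞)`, `k′ ≥ 0`,
`4k″(ρ) + (2C − ρ/2)k′(ρ) + λk(ρ) ≤ 0` for `ρ > 0` — the deterministic shadow of the killed
Ornstein–Uhlenbeck decay of `pub/ns-exp-scalarLiouville/MAP.md` §2 Lemma 2.3, whose sharp choice is the
principal Dirichlet eigenfunction of `𝒜_C` with `λ = λ₁(C)` — and `k ≤ A k(0)` on `[0, 2ρ̄]`).  Let `θ` be `C²` and bounded by `M` on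
`(t₀, 0) × E`, solving `∂ₜθ = Δθ − ⟪b, ∇θ⟫` with a drift of Type-I size `‖b(t,x)‖ ≤ C/√(−t)`
(NO divergence condition, no regularity of `b`, any finite dimension).  Then for
`t₀ < t₁ ≤ t < 0` and `‖x − y‖ ≤ 2ρ̄√(−t)`:  `|θ(t,x) − θ(t,y)| ≤ 2·M·A·(t/t₁)^λ`.
Proof: `twoPoint_comparison` with the similarity barrier `φ(s,r) = (2M/k(0))·(s/t₁)^λ·k(r/√(−s))`,
for which `φ_s − 4φ_rr − 2(C/√−s)φ_r = −((2M/k(0))(s/t₁)^λ/(−s))·(4k″ + (2C − ρ/2)k′ + λk) ≥ 0`.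
(`pub/ns-exp-scalarLiouville/MAP.md` rev 2 §2 THEOREM U, non-sharp constants.)
[cite: SereginSilvestreSverakZlatos2012, Thm 1.1 (Liouville / oscillation decay for critical drifts — Type-I-in-time variant, no divergence condition)]
[cite: KochNadirashviliSereginSverak2009, Thm 5.2 (the Type-I axisymmetric no-swirl case it models)] -/
theorem typeIDrift_twoPoint_oscillation_of_barrier {θ : ℝ → E → ℝ} {b : ℝ → E → E}
    {t₀ C M lam A ρbar : ℝ}
    (hθ : ContDiffOn ℝ 2 (uncurry θ) (Ioo t₀ 0 ×ˢ univ))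
    (hM : ∀ t ∈ Ioo t₀ 0, ∀ x, |θ t x| ≤ M) (hC : 0 ≤ C)
    (hb : ∀ t ∈ Ioo t₀ 0, ∀ x, ‖b t x‖ ≤ C / Real.sqrt (-t))
    (heq : ∀ t ∈ Ioo t₀ 0, ∀ x,
      deriv (fun s => θ s x) t = (Δ (θ t)) x - ⟪b t x, gradient (θ t) x⟫)
    {k k' k'' : ℝ → ℝ} (hk0 : 0 < k 0) (hk1 : ∀ ρ, HasDerivAt k (k' ρ) ρ)
    (hk2 : ∀ ρ, HasDerivAt k' (k'' ρ) ρ) (hkmono : ∀ ρ, 0 ≤ ρ → k 0 ≤ k ρ)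
    (hk'0 : ∀ ρ, 0 < ρ → 0 ≤ k' ρ)
    (hkin : ∀ ρ, 0 < ρ → 4 * k'' ρ + (2 * C - ρ / 2) * k' ρ + lam * k ρ ≤ 0)
    (hkA : ∀ ρ, 0 ≤ ρ → ρ ≤ 2 * ρbar → k ρ ≤ A * k 0) (hlam : 0 ≤ lam) :
    ∀ t₁ t : ℝ, t₀ < t₁ → t₁ ≤ t → t < 0 → ∀ x y : E,
      ‖x - y‖ ≤ 2 * ρbar * Real.sqrt (-t) → |θ t x - θ t y| ≤ 2 * M * A * (t / t₁) ^ lam := by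
  intro t₁ t ht₀ ht₁ ht x y hxy
  have hM0 : 0 ≤ M := le_trans (abs_nonneg _) (hM t ⟨lt_of_lt_of_le ht₀ ht₁, ht⟩ x)
  set B : ℝ := 2 * M / k 0 with hB
  have hB0 : 0 ≤ B := div_nonneg (by positivity) hk0.le
  have hBk : B * k 0 = 2 * M := by rw [hB]; field_simp
  -- abbreviations: `q s = s/t₁ > 0`, `u s = √(−s) > 0`
  have hq : ∀ s, s < 0 → 0 < s / t₁ := fun s hs => div_pos_of_neg_of_neg hs (by linarith)
  have hu : ∀ s, s < 0 → 0 < Real.sqrt (-s) := fun s hs => Real.sqrt_pos.2 (by linarith)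
  have hu2 : ∀ s, s < 0 → Real.sqrt (-s) ^ 2 = -s := fun s hs => Real.sq_sqrt (by linarith)
  -- the barrier and its derivatives
  set φ : ℝ → ℝ → ℝ := fun s r => B * (s / t₁) ^ lam * k (r / Real.sqrt (-s)) with hφ
  set φr : ℝ → ℝ → ℝ := fun s r =>
    B * (s / t₁) ^ lam * (k' (r / Real.sqrt (-s)) / Real.sqrt (-s)) with hφr
  set φrr : ℝ → ℝ → ℝ := fun s r =>
    B * (s / t₁) ^ lam * (k'' (r / Real.sqrt (-s)) / Real.sqrt (-s) ^ 2) with hφrr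
  set φt : ℝ → ℝ → ℝ := fun s r =>
    B * (s / t₁) ^ lam / Real.sqrt (-s) ^ 2 *
      (-(lam * k (r / Real.sqrt (-s))) + (r / Real.sqrt (-s)) / 2 * k' (r / Real.sqrt (-s))) with hφt
  set Λ : ℝ → ℝ := fun s => C / Real.sqrt (-s) with hΛ
  have hIcc : ∀ s ∈ Icc t₁ t, s < 0 ∧ s ∈ Ioo t₀ 0 := fun s hs =>
    ⟨lt_of_le_of_lt hs.2 ht, lt_of_lt_of_le ht₀ hs.1, lt_of_le_of_lt hs.2 ht⟩
  ---------------------------------------------------------------- hypotheses of the comparison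
  have cmp := twoPoint_comparison (θ := θ) (b := b) (Λ := Λ) (φ := φ) (φt := φt) (φr := φr)
    (φrr := φrr) (tlo := t₀) (thi := 0) (T₁ := t₁) (T₂ := t) (M := M) (Λbar := C / Real.sqrt (-t))
    ht₀ ht₁ ht hθ (fun s hs => hM s (hIcc s hs).2)
    (fun s hs => div_nonneg hC (hu s (hIcc s hs).1).le)
    (fun s hs => by
      have h1 : Real.sqrt (-t) ≤ Real.sqrt (-s) := Real.sqrt_le_sqrt (by linarith [hs.2])
      exact div_le_div_of_nonneg_left hC (hu t ht) h1)
    (fun s hs => hb s (hIcc s hs).2) (fun s hs => heq s (hIcc s hs).2)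
    ?hc ?h0 ?hr ?hrr ?ht' ?hr0 ?hin ?hini
  ---------------------------------------------------------------- conclusion from the comparison
  · have h1 := cmp t ⟨ht₁, le_rfl⟩ x y
    have h2 := cmp t ⟨ht₁, le_rfl⟩ y x
    rw [norm_sub_rev] at h2
    have hρ : ‖x - y‖ / Real.sqrt (-t) ≤ 2 * ρbar := by
      rw [div_le_iff₀ (hu t ht)]; exact hxy
    have hkle := hkA _ (div_nonneg (norm_nonneg _) (hu t ht).le) hρ
    have hqt : 0 ≤ (t / t₁) ^ lam := Real.rpow_nonneg (hq t ht).le lam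
    have hφle : φ t ‖x - y‖ ≤ 2 * M * A * (t / t₁) ^ lam := by
      simp only [hφ]
      calc B * (t / t₁) ^ lam * k (‖x - y‖ / Real.sqrt (-t))
          ≤ B * (t / t₁) ^ lam * (A * k 0) := mul_le_mul_of_nonneg_left hkle (mul_nonneg hB0 hqt)
        _ = 2 * M * A * (t / t₁) ^ lam := by
            rw [show B * (t / t₁) ^ lam * (A * k 0) = (B * k 0) * A * (t / t₁) ^ lam by ring, hBk]
    rw [abs_le]
    constructor <;> linarith
  ---------------------------------------------------------------- (hc) continuity of the barrier
  · have hcq : ContinuousOn (fun p : ℝ × ℝ => (p.1 / t₁) ^ lam) (Icc t₁ t ×ˢ Ici 0) := by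
      apply ContinuousOn.rpow_const (by fun_prop)
      exact fun p _ => Or.inr hlam
    have hck : Continuous k := continuous_iff_continuousAt.2 fun ρ => (hk1 ρ).continuousAt
    have hcr : ContinuousOn (fun p : ℝ × ℝ => p.2 / Real.sqrt (-p.1)) (Icc t₁ t ×ˢ Ici 0) := by
      apply ContinuousOn.div (by fun_prop) (by fun_prop)
      exact fun p hp => (hu p.1 (hIcc p.1 hp.1).1).ne'
    have hall : ContinuousOn (fun p : ℝ × ℝ => B * (p.1 / t₁) ^ lam * k (p.2 / Real.sqrt (-p.1)))
        (Icc t₁ t ×ˢ Ici 0) :=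
      (continuousOn_const.mul hcq).mul (hck.comp_continuousOn hcr)
    exact hall.congr fun p _ => by simp only [uncurry, hφ]
  ---------------------------------------------------------------- (h0) nonnegativity
  · intro s hs r hr
    have hs0 := (hIcc s hs).1
    have hkr : 0 ≤ k (r / Real.sqrt (-s)) :=
      le_trans hk0.le (hkmono _ (div_nonneg hr (hu s hs0).le))
    simp only [hφ]
    exact mul_nonneg (mul_nonneg hB0 (Real.rpow_nonneg (hq s hs0).le lam)) hkr
  ---------------------------------------------------------------- (hr) first radial derivative
  · intro s hs r _
    have hs0 := (hIcc s hs).1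
    have hl : HasDerivAt (fun r' : ℝ => r' / Real.sqrt (-s)) (1 / Real.sqrt (-s)) r := by
      simpa using (hasDerivAt_id r).div_const (Real.sqrt (-s))
    have h1 := (hk1 (r / Real.sqrt (-s))).comp r hl
    have h2 := h1.const_mul (B * (s / t₁) ^ lam)
    refine h2.congr_deriv ?_
    simp only [hφr]
    field_simp
  ---------------------------------------------------------------- (hrr) second radial derivative
  · intro s hs r _
    have hs0 := (hIcc s hs).1
    have hune := (hu s hs0).ne'
    have hl : HasDerivAt (fun r' : ℝ => r' / Real.sqrt (-s)) (1 / Real.sqrt (-s)) r := by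
      simpa using (hasDerivAt_id r).div_const (Real.sqrt (-s))
    have h1 : HasDerivAt (fun r' : ℝ => k' (r' / Real.sqrt (-s)))
        (k'' (r / Real.sqrt (-s)) * (1 / Real.sqrt (-s))) r := (hk2 (r / Real.sqrt (-s))).comp r hl
    have h2 : HasDerivAt (fun r' : ℝ => B * (s / t₁) ^ lam * (k' (r' / Real.sqrt (-s)) / Real.sqrt (-s)))
        (B * (s / t₁) ^ lam * (k'' (r / Real.sqrt (-s)) * (1 / Real.sqrt (-s)) / Real.sqrt (-s))) r :=
      (h1.div_const (Real.sqrt (-s))).const_mul (B * (s / t₁) ^ lam)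
    refine h2.congr_deriv ?_
    simp only [hφrr]
    field_simp
  ---------------------------------------------------------------- (ht') time derivative
  · intro s hs r hr
    have hs0 : s < 0 := lt_of_le_of_lt hs.2 ht
    have hqs := hq s hs0
    have hune := (hu s hs0).ne'
    -- `(s/t₁)^λ`
    have hd1 : HasDerivAt (fun σ : ℝ => (σ / t₁) ^ lam) (1 / t₁ * lam * (s / t₁) ^ (lam - 1)) s := by
      have := ((hasDerivAt_id s).div_const t₁).rpow_const (p := lam) (Or.inl hqs.ne')
      simpa using this
    have hd1' : HasDerivAt (fun σ : ℝ => (σ / t₁) ^ lam) (-(lam * (s / t₁) ^ lam) / Real.sqrt (-s) ^ 2) s := by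
      refine hd1.congr_deriv ?_
      rw [Real.rpow_sub_one hqs.ne', hu2 s hs0]
      have ht1 : t₁ ≠ 0 := by linarith
      have hs1 : s ≠ 0 := hs0.ne
      field_simp
    -- `k (r/√(−σ))`
    have hd2 : HasDerivAt (fun σ : ℝ => r / Real.sqrt (-σ)) (r * (1 / (2 * (-s) * Real.sqrt (-s)))) s := by
      have := (hasDerivAt_inv_sqrt_neg hs0).const_mul r
      simpa [div_eq_mul_inv] using this
    have hd3 : HasDerivAt (fun σ : ℝ => k (r / Real.sqrt (-σ)))
        (k' (r / Real.sqrt (-s)) * (r * (1 / (2 * (-s) * Real.sqrt (-s))))) s :=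
      (hk1 (r / Real.sqrt (-s))).comp s hd2
    have hd4 : HasDerivAt (fun σ : ℝ => B * ((σ / t₁) ^ lam * k (r / Real.sqrt (-σ))))
        (B * (-(lam * (s / t₁) ^ lam) / Real.sqrt (-s) ^ 2 * k (r / Real.sqrt (-s)) +
          (s / t₁) ^ lam * (k' (r / Real.sqrt (-s)) * (r * (1 / (2 * (-s) * Real.sqrt (-s))))))) s :=
      (hd1'.mul hd3).const_mul B
    refine (hd4.congr_of_eventuallyEq ?_).congr_deriv ?_
    · exact Filter.Eventually.of_forall fun σ => by simp only [hφ]; ring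
    · simp only [hφt]
      rw [hu2 s hs0]
      have hs1 : (-s) ≠ 0 := by linarith
      field_simp
      ring
  ---------------------------------------------------------------- (hr0) monotone barrier
  · intro s hs r hr
    have hs0 := (hIcc s hs).1
    have h1 : 0 ≤ k' (r / Real.sqrt (-s)) := hk'0 _ (div_pos hr (hu s hs0))
    simp only [hφr]
    exact mul_nonneg (mul_nonneg hB0 (Real.rpow_nonneg (hq s hs0).le lam)) (div_nonneg h1 (hu s hs0).le)
  ---------------------------------------------------------------- (hin) the barrier inequality
  · intro s hs r hr
    have hs0 : s < 0 := lt_of_le_of_lt hs.2 ht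
    have hus := hu s hs0
    have hune := hus.ne'
    set ρ : ℝ := r / Real.sqrt (-s) with hρ
    have hρ0 : 0 < ρ := div_pos hr hus
    have hprof := hkin ρ hρ0
    have hfac : 0 ≤ B * (s / t₁) ^ lam / Real.sqrt (-s) ^ 2 := by
      have := Real.rpow_nonneg (hq s hs0).le lam
      positivity
    have key : φt s r - (4 * φrr s r + 2 * Λ s * φr s r) =
        B * (s / t₁) ^ lam / Real.sqrt (-s) ^ 2 * (-(4 * k'' ρ + (2 * C - ρ / 2) * k' ρ + lam * k ρ)) := by
      simp only [hφt, hφrr, hφr, hΛ, hρ]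
      field_simp
      ring
    have : 0 ≤ φt s r - (4 * φrr s r + 2 * Λ s * φr s r) := by
      rw [key]; exact mul_nonneg hfac (by linarith)
    linarith
  ---------------------------------------------------------------- (hini) initial domination
  · intro r hr
    have ht1 : t₁ < 0 := lt_of_le_of_lt ht₁ ht
    have h1 : (t₁ / t₁) ^ lam = 1 := by rw [div_self ht1.ne, Real.one_rpow]
    have h2 : k 0 ≤ k (r / Real.sqrt (-t₁)) := hkmono _ (div_nonneg hr (hu t₁ ht1).le)
    simp only [hφ, h1, mul_one]
    calc 2 * M = B * k 0 := hBk.symm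
      _ ≤ B * k (r / Real.sqrt (-t₁)) := mul_le_mul_of_nonneg_left h2 hB0

end Barrier

end TypeIDrift

end Literature.Analysis.FluidPDE

end
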